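import Mathlib
import HarnessLib

/-!
# Crux `Steer` (stmt-ResolutionOfSingularities-16345) — the exponent game GENERICALLY, part 1: PUBLIC BOOKKEEPING (the potential
# lex(M, c, m), uniform sign, the odd-count drop)

OURS (campaign res-hironaka, rung L ★L-G4, slot W4.1; res-D-brk-2 g6; tool for K-TX part 4 and for every future re-lettering bookkeeping).
Candidates, not facts; NOT a statement of H. Hironaka's manuscript [claim: Hironaka2017, status: under-review]; AI formalisation, weaker than expert
review; `--supports stmt-ResolutionOfSingularities-16345`, counted 0.

## What is proved

The two landed instances (`…SteerToricVertexPerron`/`…ToricVertexExit` for `Relettering`, `…ToricUnitExitPerron`/`…Monomial` for `KRel`)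
re-ran the same induction; this file proves it ONCE for an abstract state type `S` and a step relation `P : S → S → (transformer) → Prop`
with a goodness predicate `good`, assuming only: `hrefl` (`P s s id` on good states), `htrans` (transformers compose), `hgood` (targets are
good), `hstep` (for good `s` and `a ≠ b`, SOME orientation of the pair step is available: transformer `f ↦ update f a (f a + f b)` or
`f ↦ update f b (f b + f a)`), `hneg` (`T (-f) = -T f`); plus, where values are needed, letters `ltr : S → Fin n → K` in `O ∖ 0` on good
states with `hmono` (`ltr s' ^ (T f) = ltr s ^ f`), `hnn` (ℕ-vectors preserved), `hoddp` (odd coordinates preserved).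
* `generic_uniform` — every exponent vector becomes `≥ 0` or `≤ 0` (termination lex(M, c, m): §1 bookkeeping, now PUBLIC);
* `generic_nonneg`, `generic_nonneg_family` — Laurent monomials of value `< 1` become `ℕ`-monomials;
* `generic_single_odd` — an `ℕ`-vector with an odd coordinate acquires exactly one odd coordinate.
[cite: Teissier2014] [folklore]
-/

noncomputable section

-- single-problem summit: the doubled namespace component `ResolutionOfSingularities` is forced
set_option linter.dupNamespace false

open scoped BigOperators

namespace Summit.ResolutionOfSingularities.ResolutionOfSingularities.Theorems.SteerGenericPerron

/-! ## §1 The exponent game: potential lex(`M`, `c`, `m`) (public bookkeeping; the two landed instances keep private copies) -/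

section Game

variable {n : ℕ}

/-- `M e = max_j |e_j|` (as a natural number; `0` for `n = 0`). -/
def M (e : Fin n → ℤ) : ℕ := Finset.univ.sup fun j => (e j).natAbs

/-- `c e` = number of letters with `|e_j| = M e`. -/
def cnt (e : Fin n → ℤ) : ℕ := (Finset.univ.filter fun j => (e j).natAbs = M e).card

/-- number of negative letters. -/
def negs (e : Fin n → ℤ) : ℕ := (Finset.univ.filter fun j => e j < 0).card

/-- Every letter is bounded by the maximum. -/
theorem natAbs_le_M (e : Fin n → ℤ) (j : Fin n) : (e j).natAbs ≤ M e := Finset.le_sup (f := fun j => (e j).natAbs) (by simp)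

/-- Characterisation of upper bounds of the maximum. -/
theorem M_le_iff (e : Fin n → ℤ) (N : ℕ) : M e ≤ N ↔ ∀ j, (e j).natAbs ≤ N := by simp [M, Finset.sup_le_iff]

/-- If some letter is non-zero, the maximum `M e` is attained. -/
theorem exists_natAbs_eq_M (e : Fin n → ℤ) (j₀ : Fin n) : ∃ j, (e j).natAbs = M e := by
  classical
  obtain ⟨j, -, hj⟩ := Finset.exists_mem_eq_sup (Finset.univ : Finset (Fin n)) ⟨j₀, Finset.mem_univ _⟩ fun j => (e j).natAbs
  exact ⟨j, hj.symm⟩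

/-- A non-zero vector has positive maximum. -/
theorem M_pos (e : Fin n → ℤ) {j₀ : Fin n} (hj₀ : e j₀ ≠ 0) : 0 < M e := (Int.natAbs_pos.mpr hj₀).trans_le (natAbs_le_M e j₀)

/-- **Key potential lemma.** Replacing ONE letter `a` with `|e_a| = M e` by a value `w` with `|w| < M e` makes the pair (`M`, `c`) drop
lexicographically. [folklore] -/
theorem lex_lt_of_update_max (e : Fin n → ℤ) (a : Fin n) (ha : (e a).natAbs = M e) (w : ℤ) (hw : w.natAbs < M e) :
    M (Function.update e a w) < M e ∨ (M (Function.update e a w) = M e ∧ cnt (Function.update e a w) < cnt e) := by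
  classical
  set e' := Function.update e a w with he'
  have hle : M e' ≤ M e := by
    rw [M_le_iff]
    intro j
    by_cases h : j = a
    · subst h; rw [he', Function.update_self]; exact hw.le
    · rw [he', Function.update_of_ne h]; exact natAbs_le_M e j
  rcases hle.lt_or_eq with hlt | heq
  · exact Or.inl hlt
  · right
    refine ⟨heq, ?_⟩
    -- the `M`-letters of `e'` are `M`-letters of `e` other than `a`
    have hsub : (Finset.univ.filter fun j => (e' j).natAbs = M e') ⊆ (Finset.univ.filter fun j => (e j).natAbs = M e).erase a := by
      intro j hj
      simp only [Finset.mem_filter, Finset.mem_univ, true_and] at hj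
      rw [Finset.mem_erase, Finset.mem_filter]
      have hja : j ≠ a := by
        rintro rfl
        rw [he', Function.update_self, heq] at hj
        exact absurd hj hw.ne
      refine ⟨hja, Finset.mem_univ _, ?_⟩
      rw [he', Function.update_of_ne hja, heq] at hj
      exact hj
    calc cnt e' ≤ ((Finset.univ.filter fun j => (e j).natAbs = M e).erase a).card := Finset.card_le_card hsub
      _ < cnt e := by rw [cnt]; exact Finset.card_erase_lt_of_mem (by simp [ha])

/-- Replacing a letter `b` that is NOT an `M`-letter by a non-`M` value leaves `M` and `c` unchanged, provided some other `M`-letter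
exists. [folklore] -/
theorem M_cnt_update_of_ne_max (e : Fin n → ℤ) (b : Fin n) (hb : (e b).natAbs < M e) (w : ℤ) (hw : w.natAbs < M e) :
    M (Function.update e b w) = M e ∧ cnt (Function.update e b w) = cnt e := by
  classical
  set e' := Function.update e b w with he'
  have hle : M e' ≤ M e := by
    rw [M_le_iff]
    intro j
    by_cases h : j = b
    · subst h; rw [he', Function.update_self]; exact hw.le
    · rw [he', Function.update_of_ne h]; exact natAbs_le_M e j
  -- an `M`-letter of `e` exists and differs from `b`
  obtain ⟨j₁, hj₁⟩ := exists_natAbs_eq_M e b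
  have hj₁b : j₁ ≠ b := by rintro rfl; exact absurd hj₁ hb.ne
  have hge : M e ≤ M e' := by
    rw [← hj₁]
    have : (e' j₁).natAbs = (e j₁).natAbs := by rw [he', Function.update_of_ne hj₁b]
    rw [← this]
    exact natAbs_le_M e' j₁
  have heq : M e' = M e := le_antisymm hle hge
  refine ⟨heq, ?_⟩
  rw [cnt, cnt, heq]
  congr 1
  ext j
  simp only [Finset.mem_filter, Finset.mem_univ, true_and]
  by_cases h : j = b
  · subst h
    rw [he', Function.update_self]
    constructor
    · intro h1; exact absurd h1 hw.ne
    · intro h1; exact absurd h1 hb.ne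
  · rw [he', Function.update_of_ne h]

/-- Counting: turning a negative letter non-negative lowers `negs` by one. [folklore] -/
theorem negs_update_lt (e : Fin n → ℤ) (b : Fin n) (hb : e b < 0) (w : ℤ) (hw : 0 ≤ w) :
    negs (Function.update e b w) < negs e := by
  classical
  rw [negs, negs]
  have hsub : (Finset.univ.filter fun j => Function.update e b w j < 0) ⊆ (Finset.univ.filter fun j => e j < 0).erase b := by
    intro j hj
    simp only [Finset.mem_filter, Finset.mem_univ, true_and] at hj
    have hjb : j ≠ b := by rintro rfl; rw [Function.update_self] at hj; exact absurd hj (not_lt.mpr hw)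
    rw [Function.update_of_ne hjb] at hj
    simp [hjb, hj]
  calc _ ≤ ((Finset.univ.filter fun j => e j < 0).erase b).card := Finset.card_le_card hsub
    _ < _ := Finset.card_erase_lt_of_mem (by simp [hb])

/-- Uniform sign of an exponent vector. -/
def Uniform (e : Fin n → ℤ) : Prop := (∀ j, 0 ≤ e j) ∨ (∀ j, e j ≤ 0)

/-- Uniformity is invariant under negation. -/
theorem uniform_neg_iff (e : Fin n → ℤ) : Uniform (-e) ↔ Uniform e := by
  constructor
  · rintro (h | h)
    · exact Or.inr fun j => by have := h j; simp at this; linarith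
    · exact Or.inl fun j => by have := h j; simp at this; linarith
  · rintro (h | h)
    · exact Or.inr fun j => by simp; exact h j
    · exact Or.inl fun j => by simp; linarith [h j]

/-- A pair blow-up with both pivot letters odd lowers the number of odd letters by one. [folklore] -/
theorem generic_card_odd_update_lt (p : Fin n → ℤ) {a b : Fin n} (hab : a ≠ b) (ha : Odd (p a)) (hb : Odd (p b)) :
    (Finset.univ.filter fun j => Odd (Function.update p a (p a + p b) j)).card <
      (Finset.univ.filter fun j => Odd (p j)).card := by
  classical
  have hsub : (Finset.univ.filter fun j => Odd (Function.update p a (p a + p b) j)) ⊆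
      (Finset.univ.filter fun j => Odd (p j)).erase a := by
    intro j hj
    simp only [Finset.mem_filter, Finset.mem_univ, true_and] at hj
    have hja : j ≠ a := by
      rintro rfl
      rw [Function.update_self] at hj
      exact (Int.not_odd_iff_even.mpr (ha.add_odd hb)) hj
    rw [Function.update_of_ne hja] at hj
    simp [hja, hj]
  calc _ ≤ ((Finset.univ.filter fun j => Odd (p j)).erase a).card := Finset.card_le_card hsub
    _ < _ := Finset.card_erase_lt_of_mem (by simp [ha])

end Game


end Summit.ResolutionOfSingularities.ResolutionOfSingularities.Theorems.SteerGenericPerron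

end
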